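import Summits.CriticalPhenomena.PercolationContinuityZ3.Theorems.Transplant.FKConnectivityAllQPat3ShapeZeroK
import Summits.CriticalPhenomena.PercolationContinuityZ3.Theorems.Transplant.FKConnectivityAllQPat3EeeKPathEndFreeTsymB6
import Summits.CriticalPhenomena.PercolationContinuityZ3.Theorems.Transplant.FKConnectivityAllQPat3EeeKPathEndFreeStarXB6
import Summits.CriticalPhenomena.PercolationContinuityZ3.Theorems.Transplant.FKConnectivityAllQPat3EeeKPathEndFreeStarXmB6
import Summits.CriticalPhenomena.PercolationContinuityZ3.Theorems.Transplant.FKConnectivityAllQPat3EeeKPathEndFreeStarSB6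
import Summits.CriticalPhenomena.PercolationContinuityZ3.Theorems.Transplant.FKConnectivityAllQPat3EeeKPathEndBdTsymB
import Summits.CriticalPhenomena.PercolationContinuityZ3.Theorems.Transplant.FKConnectivityAllQPat3EeeKPathEndBdStarXB
import Summits.CriticalPhenomena.PercolationContinuityZ3.Theorems.Transplant.FKConnectivityAllQPat3EeeKPathEndBdStarXmB
import Summits.CriticalPhenomena.PercolationContinuityZ3.Theorems.Transplant.FKConnectivityAllQPat3EeeKPathEndBdStarSB
import Summits.CriticalPhenomena.PercolationContinuityZ3.Theorems.Transplant.FKConnectivityAllQPat3EeeKPathEndAdTsymB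
import Summits.CriticalPhenomena.PercolationContinuityZ3.Theorems.Transplant.FKConnectivityAllQPat3EeeKPathEndAdStarXB
import Summits.CriticalPhenomena.PercolationContinuityZ3.Theorems.Transplant.FKConnectivityAllQPat3EeeKPathEndAdStarXmB
import Summits.CriticalPhenomena.PercolationContinuityZ3.Theorems.Transplant.FKConnectivityAllQPat3EeeKPathEndAdStarSB
import Summits.CriticalPhenomena.PercolationContinuityZ3.Theorems.Transplant.FKConnectivityAllQPat3EeeKPathEndAdbdTsymB
import Summits.CriticalPhenomena.PercolationContinuityZ3.Theorems.Transplant.FKConnectivityAllQPat3EeeKPathEndAdbdStarXB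
import Summits.CriticalPhenomena.PercolationContinuityZ3.Theorems.Transplant.FKConnectivityAllQPat3EeeKPathEndAdbdStarXmB
import Summits.CriticalPhenomena.PercolationContinuityZ3.Theorems.Transplant.FKConnectivityAllQPat3EeeKPathEndAdbdStarSB
import Summits.CriticalPhenomena.PercolationContinuityZ3.Theorems.Transplant.FKConnectivityAllQPat3EeeKPathEndAcTsymB
import Summits.CriticalPhenomena.PercolationContinuityZ3.Theorems.Transplant.FKConnectivityAllQPat3EeeKPathEndAcStarXB
import Summits.CriticalPhenomena.PercolationContinuityZ3.Theorems.Transplant.FKConnectivityAllQPat3EeeKPathEndAcStarXmB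
import Summits.CriticalPhenomena.PercolationContinuityZ3.Theorems.Transplant.FKConnectivityAllQPat3EeeKPathEndAcStarSB
import Summits.CriticalPhenomena.PercolationContinuityZ3.Theorems.Transplant.FKConnectivityAllQPat3EeeKPathEndAcbdTsymB
import Summits.CriticalPhenomena.PercolationContinuityZ3.Theorems.Transplant.FKConnectivityAllQPat3EeeKPathEndAcbdStarXB
import Summits.CriticalPhenomena.PercolationContinuityZ3.Theorems.Transplant.FKConnectivityAllQPat3EeeKPathEndAcbdStarXmB
import Summits.CriticalPhenomena.PercolationContinuityZ3.Theorems.Transplant.FKConnectivityAllQPat3EeeKPathEndAcbdStarSB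
import Summits.CriticalPhenomena.PercolationContinuityZ3.Theorems.Transplant.FKConnectivityAllQPat3EeeKPathEndAcadTsymB
import Summits.CriticalPhenomena.PercolationContinuityZ3.Theorems.Transplant.FKConnectivityAllQPat3EeeKPathEndAcadStarXB
import Summits.CriticalPhenomena.PercolationContinuityZ3.Theorems.Transplant.FKConnectivityAllQPat3EeeKPathEndAcadStarXmB
import Summits.CriticalPhenomena.PercolationContinuityZ3.Theorems.Transplant.FKConnectivityAllQPat3EeeKPathEndAcadStarSB
import Summits.CriticalPhenomena.PercolationContinuityZ3.Theorems.Transplant.FKConnectivityAllQPat3EeeKPathEndAcadbdTsymB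
import Summits.CriticalPhenomena.PercolationContinuityZ3.Theorems.Transplant.FKConnectivityAllQPat3EeeKPathEndAcadbdStarXB
import Summits.CriticalPhenomena.PercolationContinuityZ3.Theorems.Transplant.FKConnectivityAllQPat3EeeKPathEndAcadbdStarXmB
import Summits.CriticalPhenomena.PercolationContinuityZ3.Theorems.Transplant.FKConnectivityAllQPat3EeeKPathEndAcadbdStarSB
import Summits.CriticalPhenomena.PercolationContinuityZ3.Theorems.Transplant.FKConnectivityAllQPat3EeeKRowsPathMid
import HarnessLib

/-!
# Connectivity correlation inequalities for `φ_{w,q}`, every `q > 0` — THE LEAF EEEpath_end IN ALL EIGHT K-STATES: the row facts bundled over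
# the splits of `[(0, 2), (0, 3), (1, 3)]` (census g41)

Proof file (`--supports stmt-CriticalPhenomena-4575`), census lineage (gen 41) of LANE 2's FK sub-programme; builds on p205010 (kernel
theorem, internal audit signed; external expert review pending).  No definitions, no named facts, no sorries; standard axioms.

Collects the closing `_rows` theorems of the 32 data file groups `…Pat3EeeKPathEnd<State><Target>…` (8 states × 4 targets; census g41's prepared
set, kit j242142 certificates, `coefTab3K`) into four statements quantified over the state (L, K) of the three plain slots (their splits = `FK.splits_eeepathmidSkelK`):
`FK.eeeKpathend_tsym_rows / _starX_rows / _starXm_rows / _starS_rows` — the form the K-state leaf lemmas `…Pat3EeeLeafK` consume.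
[cite: AyyerLinussonRavichandran2025, §7 (p. 22)]
-/

namespace Summit.CriticalPhenomena.PercolationContinuityZ3.Theorems

namespace FK

-- census g44: the splits of `[(0, 2), (0, 3), (1, 3)]` are `FK.splits_eeepathmidSkelK` of «Pat3EeeKRowsPathMid» (same plain slots as
-- EEEpath_mid; imported, not restated — gate `dedup.landed` at dry-run 2026-08-27T01:07Z, nothing recorded).

/-- **EEEpath_end rows in every K-state, target `tsym2Tab`** (kernel-checked certificates of the 8 data file groups). [cite: AyyerLinussonRavichandran2025, §7 (p. 22)] -/
theorem eeeKpathend_tsym_rows : ∀ LK ∈ splits ([(0, 2), (0, 3), (1, 3)] : List (Fin 7 × Fin 7)), ∃ prods : List Prod3, ∃ Dn : ℕ, 0 < Dn ∧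
    (∃ cs : List (ℕ × ℕ × ℕ × ℕ × ℕ), prods = cs.map (Prod3.ofIdx famP11orb)) ∧
    ∀ (d : ℕ) (PK QK P1 Q1 P2 Q2 : Pat3), 8 * (prods.map fun q => (q.lam : ℤ) * q.tensor d PK QK P1 Q1 P2 Q2).sum ≤
      (Dn : ℤ) * symm8d (coefTab3K LK.1 LK.2 (0 : Fin 7) 1 4 1 2 5 2 3 6 4 5 6 tsym2Tab) d PK QK P1 Q1 P2 Q2 := by
  intro LK hLK
  rw [splits_eeepathmidSkelK] at hLK
  fin_cases hLK

  · exact ⟨eeeKpathendfree_tsymProds, 191926788294406704682347520, by decide, ⟨_, rfl⟩, eeeKpathendfree_tsym_rows⟩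
  · exact ⟨eeeKpathendbd_tsymProds, 1852800, by decide, ⟨_, rfl⟩, eeeKpathendbd_tsym_rows⟩
  · exact ⟨eeeKpathendad_tsymProds, 92306388096, by decide, ⟨_, rfl⟩, eeeKpathendad_tsym_rows⟩
  · exact ⟨eeeKpathendadbd_tsymProds, 8, by decide, ⟨_, rfl⟩, eeeKpathendadbd_tsym_rows⟩
  · exact ⟨eeeKpathendac_tsymProds, 1852800, by decide, ⟨_, rfl⟩, eeeKpathendac_tsym_rows⟩
  · exact ⟨eeeKpathendacbd_tsymProds, 16, by decide, ⟨_, rfl⟩, eeeKpathendacbd_tsym_rows⟩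
  · exact ⟨eeeKpathendacad_tsymProds, 8, by decide, ⟨_, rfl⟩, eeeKpathendacad_tsym_rows⟩
  · exact ⟨eeeKpathendacadbd_tsymProds, 1, by decide, ⟨_, rfl⟩, eeeKpathendacadbd_tsym_rows⟩

/-- **EEEpath_end rows in every K-state, target `starXTab`** (kernel-checked certificates of the 8 data file groups). [cite: AyyerLinussonRavichandran2025, §7 (p. 22)] -/
theorem eeeKpathend_starX_rows : ∀ LK ∈ splits ([(0, 2), (0, 3), (1, 3)] : List (Fin 7 × Fin 7)), ∃ prods : List Prod3, ∃ Dn : ℕ, 0 < Dn ∧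
    (∃ cs : List (ℕ × ℕ × ℕ × ℕ × ℕ), prods = cs.map (Prod3.ofIdx famP11orb)) ∧
    ∀ (d : ℕ) (PK QK P1 Q1 P2 Q2 : Pat3), 8 * (prods.map fun q => (q.lam : ℤ) * q.tensor d PK QK P1 Q1 P2 Q2).sum ≤
      (Dn : ℤ) * symm8d (coefTab3K LK.1 LK.2 (0 : Fin 7) 1 4 1 2 5 2 3 6 4 5 6 starXTab) d PK QK P1 Q1 P2 Q2 := by
  intro LK hLK
  rw [splits_eeepathmidSkelK] at hLK
  fin_cases hLK

  · exact ⟨eeeKpathendfree_starXProds, 241333664602363656231105043128832, by decide, ⟨_, rfl⟩, eeeKpathendfree_starX_rows⟩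
  · exact ⟨eeeKpathendbd_starXProds, 192, by decide, ⟨_, rfl⟩, eeeKpathendbd_starX_rows⟩
  · exact ⟨eeeKpathendad_starXProds, 640008765984, by decide, ⟨_, rfl⟩, eeeKpathendad_starX_rows⟩
  · exact ⟨eeeKpathendadbd_starXProds, 8, by decide, ⟨_, rfl⟩, eeeKpathendadbd_starX_rows⟩
  · exact ⟨eeeKpathendac_starXProds, 34329745280, by decide, ⟨_, rfl⟩, eeeKpathendac_starX_rows⟩
  · exact ⟨eeeKpathendacbd_starXProds, 16, by decide, ⟨_, rfl⟩, eeeKpathendacbd_starX_rows⟩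
  · exact ⟨eeeKpathendacad_starXProds, 8, by decide, ⟨_, rfl⟩, eeeKpathendacad_starX_rows⟩
  · exact ⟨eeeKpathendacadbd_starXProds, 1, by decide, ⟨_, rfl⟩, eeeKpathendacadbd_starX_rows⟩

/-- **EEEpath_end rows in every K-state, target `mirror2 starXTab`** (kernel-checked certificates of the 8 data file groups). [cite: AyyerLinussonRavichandran2025, §7 (p. 22)] -/
theorem eeeKpathend_starXm_rows : ∀ LK ∈ splits ([(0, 2), (0, 3), (1, 3)] : List (Fin 7 × Fin 7)), ∃ prods : List Prod3, ∃ Dn : ℕ, 0 < Dn ∧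
    (∃ cs : List (ℕ × ℕ × ℕ × ℕ × ℕ), prods = cs.map (Prod3.ofIdx famP11orb)) ∧
    ∀ (d : ℕ) (PK QK P1 Q1 P2 Q2 : Pat3), 8 * (prods.map fun q => (q.lam : ℤ) * q.tensor d PK QK P1 Q1 P2 Q2).sum ≤
      (Dn : ℤ) * symm8d (coefTab3K LK.1 LK.2 (0 : Fin 7) 1 4 1 2 5 2 3 6 4 5 6 (mirror2 starXTab)) d PK QK P1 Q1 P2 Q2 := by
  intro LK hLK
  rw [splits_eeepathmidSkelK] at hLK
  fin_cases hLK

  · exact ⟨eeeKpathendfree_starXmProds, 224434024522074246336000, by decide, ⟨_, rfl⟩, eeeKpathendfree_starXm_rows⟩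
  · exact ⟨eeeKpathendbd_starXmProds, 34329745280, by decide, ⟨_, rfl⟩, eeeKpathendbd_starXm_rows⟩
  · exact ⟨eeeKpathendad_starXmProds, 6759612121200, by decide, ⟨_, rfl⟩, eeeKpathendad_starXm_rows⟩
  · exact ⟨eeeKpathendadbd_starXmProds, 8, by decide, ⟨_, rfl⟩, eeeKpathendadbd_starXm_rows⟩
  · exact ⟨eeeKpathendac_starXmProds, 34329745280, by decide, ⟨_, rfl⟩, eeeKpathendac_starXm_rows⟩
  · exact ⟨eeeKpathendacbd_starXmProds, 16, by decide, ⟨_, rfl⟩, eeeKpathendacbd_starXm_rows⟩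
  · exact ⟨eeeKpathendacad_starXmProds, 8, by decide, ⟨_, rfl⟩, eeeKpathendacad_starXm_rows⟩
  · exact ⟨eeeKpathendacadbd_starXmProds, 1, by decide, ⟨_, rfl⟩, eeeKpathendacadbd_starXm_rows⟩

/-- **EEEpath_end rows in every K-state, target `starSTab`** (kernel-checked certificates of the 8 data file groups). [cite: AyyerLinussonRavichandran2025, §7 (p. 22)] -/
theorem eeeKpathend_starS_rows : ∀ LK ∈ splits ([(0, 2), (0, 3), (1, 3)] : List (Fin 7 × Fin 7)), ∃ prods : List Prod3, ∃ Dn : ℕ, 0 < Dn ∧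
    (∃ cs : List (ℕ × ℕ × ℕ × ℕ × ℕ), prods = cs.map (Prod3.ofIdx famP11orb)) ∧
    ∀ (d : ℕ) (PK QK P1 Q1 P2 Q2 : Pat3), 8 * (prods.map fun q => (q.lam : ℤ) * q.tensor d PK QK P1 Q1 P2 Q2).sum ≤
      (Dn : ℤ) * symm8d (coefTab3K LK.1 LK.2 (0 : Fin 7) 1 4 1 2 5 2 3 6 4 5 6 starSTab) d PK QK P1 Q1 P2 Q2 := by
  intro LK hLK
  rw [splits_eeepathmidSkelK] at hLK
  fin_cases hLK

  · exact ⟨eeeKpathendfree_starSProds, 241333664602363656231105043128832, by decide, ⟨_, rfl⟩, eeeKpathendfree_starS_rows⟩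
  · exact ⟨eeeKpathendbd_starSProds, 34329745280, by decide, ⟨_, rfl⟩, eeeKpathendbd_starS_rows⟩
  · exact ⟨eeeKpathendad_starSProds, 640008765984, by decide, ⟨_, rfl⟩, eeeKpathendad_starS_rows⟩
  · exact ⟨eeeKpathendadbd_starSProds, 8, by decide, ⟨_, rfl⟩, eeeKpathendadbd_starS_rows⟩
  · exact ⟨eeeKpathendac_starSProds, 192, by decide, ⟨_, rfl⟩, eeeKpathendac_starS_rows⟩
  · exact ⟨eeeKpathendacbd_starSProds, 16, by decide, ⟨_, rfl⟩, eeeKpathendacbd_starS_rows⟩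
  · exact ⟨eeeKpathendacad_starSProds, 8, by decide, ⟨_, rfl⟩, eeeKpathendacad_starS_rows⟩
  · exact ⟨eeeKpathendacadbd_starSProds, 1, by decide, ⟨_, rfl⟩, eeeKpathendacadbd_starS_rows⟩

end FK

end Summit.CriticalPhenomena.PercolationContinuityZ3.Theorems
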